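import Summits.HodgeConjecture.HodgeConjecture.Theses.AnchorTransport
import Summits.HodgeConjecture.HodgeConjecture.Theorems.AnchorTransportVariationalHodgeCurveBase
import Summits.HodgeConjecture.HodgeConjecture.Theorems.AnchorTransportVariationalHodgeCorrespondenceTransport

/-!
# Crux `VariationalHodge` (stmt-HodgeConjecture-1076) — line `Sketch`, the lead's reshaped skeleton

The picked line `Sketch` (`Cruxes/VariationalHodge/IdeatorOneSketch.lean`) is a first-lemmas file of
the cards `tame-symbol-splitting` and `gw-section-transport`; it has no composition and no stubs, and
its three typed statements are landed (`variationalHodge_of_curveBase`, `variationalHodge_closing_*`,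
`correspondenceTransport`). This file is the lead's reshape into a concluding skeleton of the ONLY
branch that can be typed over the tree's carriers today, the `gw-section-transport` composition in
its most general ("surjectivity") form:

* reduction to smooth irreducible affine bases (landed `variationalHodge_of_affine`, unconditional;
  the sharper landed reduction to affine CURVES in the middle range, `variationalHodge_of_residual`,
  costs three named facts and is not needed for the composition);
* abstract transport (landed `complexBetti_map_fiberι_eq_of_eq`: two global classes agreeing on one
  fibre of a smooth projective family over a smooth irreducible affine base agree on every fibre);
* ONE stub, `stub_anchoredOperatorSupply`: over a smooth irreducible affine base, for a fibrewise
  rational `(p,p)` global class `A` algebraic at `s₀`, there is a family of algebraicity-preserving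
  operators `T_t : H²ᵖ(𝒳_{s₀}) → H²ᵖ(𝒳_t)` and an ALGEBRAIC anchor class `α₀` whose transports
  `T_t α₀` glue to a global class and whose anchor value is `T_{s₀} α₀ = A|_{𝒳_{s₀}}` (the card's
  relative correspondence `[T_t]^*` with non-vanishing anchor coefficient, Cayley–Hamilton form
  `α₀ = r(E) A|_{s₀}` included).

The tame-symbol half (crux over a curve ⟺ T1 tame ∧ T2 rigid) is NOT typable: the tree has no higher
Chow groups / `K₁` of the generic fibre / boundary map `∂` (the card says so itself).

COSTUME TEST (lead, cycle 1): `work/SketchCostume.lean` proves the stub is EQUIVALENT to the crux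
itself (`T_t c := if c = A|_{s₀} then A|_t else 0` for the converse), i.e. the only typable stub of
this line restates the crux — see `line-Sketch.dead.md`.
-/

noncomputable section

-- every declaration of this crux lives in `Summit.HodgeConjecture.HodgeConjecture.…` (summit = sub-problem)
set_option linter.dupNamespace false

open CategoryTheory AlgebraicGeometry TopologicalSpace MonoidalCategory
open Literature.AlgebraicGeometry.Motives Literature.AlgebraicGeometry.HodgeTheory
open Summit.HodgeConjecture.HodgeConjecture.Theses.AnchorTransport
open Summit.HodgeConjecture.HodgeConjecture.Theorems

namespace Summit.HodgeConjecture.HodgeConjecture.Cruxes.VariationalHodge.Sketch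

/-- STUB (hardest, the line's whole content): **anchored operator supply** over smooth irreducible
affine bases — a family of algebraicity-preserving operators
from the anchor fibre, an algebraic anchor class `α₀` transported FLATLY (its transports are the
fibre restrictions of one global class) with anchor value `A|_{𝒳_{s₀}}`. Intended instance
(card `gw-section-transport`): `T_t = [Γ_t]^*` for an algebraic cycle `Γ` on `𝒳 × 𝒳_{s₀}`
(section-transport / two-point Gromov–Witten correspondence), flatness = proper base change,
`α₀ = r(E) · A|_{s₀}` by Cayley–Hamilton on the `E = [Γ_{s₀}]^*`-cyclic span when the anchor
coefficient is non-zero. -/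
theorem stub_anchoredOperatorSupply :
    ∀ ⦃n : ℕ⦄ ⦃𝒳 S : SchemeOver ℂ⦄ (f : 𝒳 ⟶ S), IsSmoothProjectiveFamily f n →
      IrreducibleSpace S.left → IsAffine S.left → AlgebraicGeometry.Smooth S.hom →
      ∀ (p : ℕ) (A : complexBetti 𝒳 (2 * p)),
      (∀ s : ComplexPoints S, IsRationalClass (complexBetti.map (fiberι f s) (2 * p) A) ∧
        IsOfHodgeType n (fiberOver f s) (2 * p) p p (complexBetti.map (fiberι f s) (2 * p) A)) →
      ∀ s₀ : ComplexPoints S,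
        complexBetti.map (fiberι f s₀) (2 * p) A ∈ algebraicClasses (fiberOver f s₀) p →
      ∃ T : ∀ t : ComplexPoints S,
          complexBetti (fiberOver f s₀) (2 * p) → complexBetti (fiberOver f t) (2 * p),
        (∀ (t : ComplexPoints S) (c : complexBetti (fiberOver f s₀) (2 * p)),
          c ∈ algebraicClasses (fiberOver f s₀) p → T t c ∈ algebraicClasses (fiberOver f t) p) ∧
        ∃ α₀ : complexBetti (fiberOver f s₀) (2 * p), α₀ ∈ algebraicClasses (fiberOver f s₀) p ∧
          (∃ Gl : complexBetti 𝒳 (2 * p), ∀ t : ComplexPoints S,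
            T t α₀ = complexBetti.map (fiberι f t) (2 * p) Gl) ∧
          T s₀ α₀ = complexBetti.map (fiberι f s₀) (2 * p) A := by
  sorry

/-- GLUE (proved): anchored operator supply ⇒ the crux statement over smooth irreducible affine
bases. The global class `Gl` gluing the transports of `α₀` agrees with
`A` on the anchor fibre, hence on every fibre (`complexBetti_map_fiberι_eq_of_eq`; an affine base is
separated and quasi-compact), and `A|_{𝒳_t} = T_t α₀` is algebraic. -/
theorem affine_of_anchoredOperatorSupply
    (hsup : ∀ ⦃n : ℕ⦄ ⦃𝒳 S : SchemeOver ℂ⦄ (f : 𝒳 ⟶ S), IsSmoothProjectiveFamily f n →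
      IrreducibleSpace S.left → IsAffine S.left → AlgebraicGeometry.Smooth S.hom →
      ∀ (p : ℕ) (A : complexBetti 𝒳 (2 * p)),
      (∀ s : ComplexPoints S, IsRationalClass (complexBetti.map (fiberι f s) (2 * p) A) ∧
        IsOfHodgeType n (fiberOver f s) (2 * p) p p (complexBetti.map (fiberι f s) (2 * p) A)) →
      ∀ s₀ : ComplexPoints S,
        complexBetti.map (fiberι f s₀) (2 * p) A ∈ algebraicClasses (fiberOver f s₀) p →
      ∃ T : ∀ t : ComplexPoints S,
          complexBetti (fiberOver f s₀) (2 * p) → complexBetti (fiberOver f t) (2 * p),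
        (∀ (t : ComplexPoints S) (c : complexBetti (fiberOver f s₀) (2 * p)),
          c ∈ algebraicClasses (fiberOver f s₀) p → T t c ∈ algebraicClasses (fiberOver f t) p) ∧
        ∃ α₀ : complexBetti (fiberOver f s₀) (2 * p), α₀ ∈ algebraicClasses (fiberOver f s₀) p ∧
          (∃ Gl : complexBetti 𝒳 (2 * p), ∀ t : ComplexPoints S,
            T t α₀ = complexBetti.map (fiberι f t) (2 * p) Gl) ∧
          T s₀ α₀ = complexBetti.map (fiberι f s₀) (2 * p) A)
    ⦃n : ℕ⦄ ⦃𝒳 S : SchemeOver ℂ⦄ (f : 𝒳 ⟶ S) (hf : IsSmoothProjectiveFamily f n)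
    (hirr : IrreducibleSpace S.left) (haff : IsAffine S.left) (hsm : AlgebraicGeometry.Smooth S.hom)
    (p : ℕ) (A : complexBetti 𝒳 (2 * p))
    (hA : ∀ s : ComplexPoints S, IsRationalClass (complexBetti.map (fiberι f s) (2 * p) A) ∧
      IsOfHodgeType n (fiberOver f s) (2 * p) p p (complexBetti.map (fiberι f s) (2 * p) A))
    (hs₀ : ∃ s₀ : ComplexPoints S,
      complexBetti.map (fiberι f s₀) (2 * p) A ∈ algebraicClasses (fiberOver f s₀) p)
    (s : ComplexPoints S) :
    complexBetti.map (fiberι f s) (2 * p) A ∈ algebraicClasses (fiberOver f s) p := by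
  obtain ⟨s₀, hs₀⟩ := hs₀
  obtain ⟨T, halg, α₀, hα₀, ⟨Gl, hGl⟩, hfix⟩ :=
    hsup f hf hirr haff hsm p A hA s₀ hs₀
  haveI := hirr
  haveI := haff
  haveI := hsm
  haveI : IsAffineHom S.hom := inferInstance
  haveI : IsSeparated S.hom := inferInstance
  haveI : CompactSpace S.left := isCompact_univ_iff.mp (isAffineOpen_top S.left).isCompact
  -- `Gl` and `A` agree on the anchor fibre, hence on every fibre
  have h₀ : complexBetti.map (fiberι f s₀) (2 * p) Gl = complexBetti.map (fiberι f s₀) (2 * p) A := by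
    rw [← hGl s₀, hfix]
  have hs : complexBetti.map (fiberι f s) (2 * p) Gl = complexBetti.map (fiberι f s) (2 * p) A :=
    complexBetti_map_fiberι_eq_of_eq f hf (2 * p) Gl A s₀ s h₀
  rw [← hs, ← hGl s]
  exact halg s α₀ hα₀

/-- COMPOSITION: the crux `AnchorTransport.VariationalHodge` BY NAME from the one stub —
unconditionally: the landed reduction to smooth irreducible AFFINE bases (`variationalHodge_of_affine`)
fed with the glue `affine_of_anchoredOperatorSupply`. (The further landed reductions to affine CURVES
and to the middle range `2 ≤ p ≤ n - 2`, `variationalHodge_of_residual`, cost three named facts —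
Lefschetz `(1,1)`, hard Lefschetz, Mumford's curve through two points — and are left to whoever attacks
the stub.) -/
theorem VariationalHodge_of : VariationalHodge :=
  variationalHodge_of_affine (affine_of_anchoredOperatorSupply stub_anchoredOperatorSupply)

end Summit.HodgeConjecture.HodgeConjecture.Cruxes.VariationalHodge.Sketch

end
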